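import Literature.AlgebraicGeometry.Frobenioids.PadicKummerDualityIsoLocalField
import Literature.AlgebraicGeometry.Frobenioids.PadicKummerLocalFieldIsoIntegers
import Literature.AlgebraicGeometry.Frobenioids.PadicKummerContextConj
import HarnessLib

/-!
# Frobenioids II, Theorem 2.4 (i) at the local-field binding: two honest instances
# (Galois conjugation — UNCONDITIONAL; a valuative isomorphism of `p`-adic fields — modulo `hfs`)

Mochizuki, *The geometry of Frobenioids II: poly-Frobenioids*, Kyushu J. Math. **62** (2008) 401–460,
§2, Theorem 2.4 (i) pp. 19–20 [cite: MochizukiFrdII2008, Thm 2.4 (i) p.19], together with Definition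
2.2 (i) p. 17 ("the homomorphism `G ↠ G_A` is only determined up to composition with an inner
automorphism") and Remark 2.4.1 p. 22.

Proof-only companion (abc-iut cell, node `FrdII:Thm2.4(i)`, row W12-L12 "Assembly_i"; seat abc-iut-L1-d4,
discharger of record of Thm. 2.4 (i)(ii)) of abc-iut-L2-t12's `Def22Context.Iso.thm24i_ofLocalField`
(`PadicKummerDualityIsoLocalField.lean`: the typed `PadicKummer.Thm24i` for EVERY isomorphism of two
local-field contexts `ofLocalField Lᵢ Hᵢ … Sᵢ`, duality isomorphisms CONSTRUCTED, `p₁ = p₂` DERIVED,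
conditional only on `hfs : fs₁ ↔ fs₂`). That theorem quantifies over an ABSTRACT context isomorphism; this
file instantiates it at the two context isomorphisms of arithmetic origin constructed in the cell, which is
at once a kernel NON-VACUITY witness of the assembled statement and the two cases print has in view:
* `thm24i_conj_ofLocalField` — along the **natural action of `g ∈ G_K`** on the context of ONE object
  (abc-iut-L1-d4's `Iso.conjOfGaloisQuot`, Def. 2.2 (i) / Rem. 2.4.1): here both sides are the same
  Frobenioid, so `fs₁ = fs₂` and `hfs := Iff.rfl` — **Theorem 2.4 (i) holds with NO residual input**
  (`…_tri`: for `O^□ = O^⊳_L` even the roots-of-unity hypothesis on `S` is automatic);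
* `thm24i_ofLocalFieldTri` — along the context isomorphism induced by a **valuative isomorphism of the
  base fields** `K₁ ≃ K₂` carrying `L₁` onto `L₂` and `H₁` onto `H₂` (abc-iut-L1-d4's `Iso.ofLocalFieldTri`,
  the case of a `Ψ` of field-theoretic origin, `O^□ = O^⊳`), conditional only on `hfs`; and
  `residueChar_eq_of_ofLocalFieldTri` — its "`p₁ = p₂`" clause read alone: valuatively isomorphic finite
  extensions of `ℚ_{p₁}`, `ℚ_{p₂}` have `p₁ = p₂` (through [AbsAnab] Prop. 1.2.1 (i), abc-iut-L4's
  `galoisMLF_iso_residueChar_eq_holds`).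
No new definitions; nothing here concerns [IUTchIII]; classical Kummer theory and local Tate duality.
-/

noncomputable section

namespace Literature.AlgebraicGeometry.Frobenioids

namespace PadicKummer

namespace Def22Context

open Field IntermediateField
open scoped ValuativeRel
open Literature.AnabelianGeometry.AbsoluteAnabelian

/-! ### Along the Galois conjugation `g ∈ G_K` (one object) — unconditional -/

section Conj

variable {p : ℕ} [Fact p.Prime] {K : Type} [Field K] [ValuativeRel K] [TopologicalSpace K]
  [IsNonarchimedeanLocalField K] [CharZero K] [Algebra ℚ_[p] K] [FiniteDimensional ℚ_[p] K]
  (L : IntermediateField K (AlgebraicClosure K)) [Normal K L] [FiniteDimensional K L]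
  (H : Subgroup (absoluteGaloisGroup K)) [H.Normal] (hH : IsOpen (H : Set (absoluteGaloisGroup K)))
  (S : StableSubmonoid L) (N : ℕ) [NeZero N]

/-- **Theorem 2.4 (i), UNCONDITIONALLY, along the natural action of `g ∈ G_K`** on the arithmetic
context `ofLocalField L H … S` of an `(N, H)`-saturated object (`K ⊇ ℚ_p` finite; `S = O^□_L ∋` the
`N`-th roots of unity): the typed `Thm24i` for the comparison data of the context automorphism
`Iso.conjOfGaloisQuot … g` and the constructed duality isomorphisms — every input (`p = p`, saturation,
`F_N ≅ ℤ/N`, Kummer compatibility, (γ₁), local Tate duality for `H`) is PROVED, and "`Φ` fieldwise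
saturated iff `Φ` is" is `Iff.rfl`. (By Rem. 2.4.1 the data differ from the identity's by `g`:
abc-iut-L1-d4's `rmk241Indeterminacy_conj`.) [cite: MochizukiFrdII2008, Thm 2.4 (i) p.19] -/
theorem thm24i_conj_ofLocalField (g : absoluteGaloisGroup K) (fs : Prop)
    (hS : ∀ x : L, x ^ N = 1 → x ∈ S.toSubmonoid) (h : IsNHSaturated (ofLocalField L H hH S) N) :
    Thm24i (ofLocalField L H hH S) (ofLocalField L H hH S) N p p fs fs
      ((Iso.conjOfGaloisQuot L H hH (GalMonoid S) g).thm24Data N)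
      (dualityIsoOfLocalField L H hH S N hS h) (dualityIsoOfLocalField L H hH S N hS h) :=
  Iso.thm24i_ofLocalField (Iso.conjOfGaloisQuot L H hH (GalMonoid S) g) N fs fs Iff.rfl hS h hS

/-- The same for `O^□(A) = O^⊳_L` (Def. 2.2 (iii), `triSubmonoid`): the roots of unity lie in `O^⊳_L`
automatically, so the only hypothesis left is the object's printed standing hypothesis "`A` is
`(N, H)`-saturated". [cite: MochizukiFrdII2008, Thm 2.4 (i) p.19] -/
theorem thm24i_conj_ofLocalField_tri (g : absoluteGaloisGroup K) (fs : Prop)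
    (h : IsNHSaturated (ofLocalField L H hH (triSubmonoid K L)) N) :
    Thm24i (ofLocalField L H hH (triSubmonoid K L)) (ofLocalField L H hH (triSubmonoid K L)) N p p fs fs
      ((Iso.conjOfGaloisQuot L H hH (GalMonoid (triSubmonoid K L)) g).thm24Data N)
      (dualityIsoOfLocalField L H hH (triSubmonoid K L) N
        (fun _ hx => mem_triSubmonoid_of_pow_eq_one K L N (NeZero.pos N) hx) h)
      (dualityIsoOfLocalField L H hH (triSubmonoid K L) N
        (fun _ hx => mem_triSubmonoid_of_pow_eq_one K L N (NeZero.pos N) hx) h) :=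
  thm24i_conj_ofLocalField L H hH (triSubmonoid K L) N g fs
    (fun _ hx => mem_triSubmonoid_of_pow_eq_one K L N (NeZero.pos N) hx) h

end Conj

/-! ### Along a valuative isomorphism of the base fields (`Ψ` of field-theoretic origin) -/

section FieldIso

variable {p₁ p₂ : ℕ} [Fact p₁.Prime] [Fact p₂.Prime]
  {K₁ K₂ : Type} [Field K₁] [Field K₂] [ValuativeRel K₁] [ValuativeRel K₂]
  [TopologicalSpace K₁] [IsNonarchimedeanLocalField K₁] [CharZero K₁]
  [TopologicalSpace K₂] [IsNonarchimedeanLocalField K₂] [CharZero K₂]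
  [Algebra ℚ_[p₁] K₁] [FiniteDimensional ℚ_[p₁] K₁] [Algebra ℚ_[p₂] K₂] [FiniteDimensional ℚ_[p₂] K₂]
  (φ₀ : K₁ ≃+* K₂) (hφ₀ : ∀ x : K₁, x ∈ 𝒪[K₁] ↔ φ₀ x ∈ 𝒪[K₂])
  (φ : AlgebraicClosure K₁ ≃+* AlgebraicClosure K₂)
  (hφ : ∀ x : K₁, φ (algebraMap K₁ (AlgebraicClosure K₁) x) =
    algebraMap K₂ (AlgebraicClosure K₂) (φ₀ x))
  (L₁ : IntermediateField K₁ (AlgebraicClosure K₁)) (L₂ : IntermediateField K₂ (AlgebraicClosure K₂))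
  [Normal K₁ L₁] [FiniteDimensional K₁ L₁] [Normal K₂ L₂] [FiniteDimensional K₂ L₂]
  (hL : ∀ y : AlgebraicClosure K₁, y ∈ L₁ ↔ φ y ∈ L₂)
  (H₁ : Subgroup (absoluteGaloisGroup K₁)) [H₁.Normal]
  (hH₁ : IsOpen (H₁ : Set (absoluteGaloisGroup K₁)))
  (H₂ : Subgroup (absoluteGaloisGroup K₂)) [H₂.Normal]
  (hH₂ : IsOpen (H₂ : Set (absoluteGaloisGroup K₂)))
  (hH : H₁.map (galConjₜ φ₀ φ hφ).toMulEquiv.toMonoidHom = H₂)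
  (N : ℕ) [NeZero N]

omit [TopologicalSpace K₁] [IsNonarchimedeanLocalField K₁] [CharZero K₁] [TopologicalSpace K₂]
  [IsNonarchimedeanLocalField K₂] [CharZero K₂] in
include φ₀ hφ₀ φ hφ L₁ L₂ hL H₁ hH₁ H₂ hH₂ hH in
/-- **Theorem 2.4 (i), "`p₁ = p₂`", for a `Ψ` of field-theoretic origin**: if finite extensions
`K₁ ⊇ ℚ_{p₁}`, `K₂ ⊇ ℚ_{p₂}` are valuatively isomorphic (compatibly with chosen algebraic closures, normal
finite `Lᵢ` and open normal `Hᵢ`), then `p₁ = p₂` — the clause of Thm. 2.4 (i) read through [AbsAnab]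
Prop. 1.2.1 (i) (abc-iut-L4 `galoisMLF_iso_residueChar_eq_holds`) along abc-iut-L1-d4's context isomorphism
`Iso.ofLocalFieldTri`. [cite: MochizukiFrdII2008, Thm 2.4 (i) p.20] -/
theorem residueChar_eq_of_ofLocalFieldTri : p₁ = p₂ :=
  residueChar_eq_of_iso_ofGalois (Iso.ofLocalFieldTri φ₀ hφ₀ φ hφ L₁ L₂ hL H₁ hH₁ H₂ hH₂ hH)
    galoisMLF_iso_residueChar_eq_holds

/-- **Theorem 2.4 (i) along a valuative isomorphism of `p`-adic fields** (`O^□ = O^⊳`): the typed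
`Thm24i` for the comparison data of abc-iut-L1-d4's `Iso.ofLocalFieldTri` (induced by `φ₀ : K₁ ≃ K₂`
respecting integers, `φ : K̄₁ ≃ K̄₂` over it with `φ(L₁) = L₂`, `H₁ ↦ H₂`) and the constructed duality
isomorphisms, for an `(N, H₁)`-saturated object; conditional ONLY on "`Φ₁` fieldwise saturated iff `Φ₂`"
(`hfs`, a statement about the two `pᵢ`-adic Frobenioids' divisor monoids, cell row W12-L03).
[cite: MochizukiFrdII2008, Thm 2.4 (i) p.19] -/
theorem thm24i_ofLocalFieldTri (fs₁ fs₂ : Prop) (hfs : fs₁ ↔ fs₂)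
    (h₁ : IsNHSaturated (ofLocalField L₁ H₁ hH₁ (triSubmonoid K₁ L₁)) N) :
    Thm24i (ofLocalField L₁ H₁ hH₁ (triSubmonoid K₁ L₁)) (ofLocalField L₂ H₂ hH₂ (triSubmonoid K₂ L₂))
      N p₁ p₂ fs₁ fs₂ ((Iso.ofLocalFieldTri φ₀ hφ₀ φ hφ L₁ L₂ hL H₁ hH₁ H₂ hH₂ hH).thm24Data N)
      (dualityIsoOfLocalField L₁ H₁ hH₁ (triSubmonoid K₁ L₁) N
        (fun _ hx => mem_triSubmonoid_of_pow_eq_one K₁ L₁ N (NeZero.pos N) hx) h₁)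
      (dualityIsoOfLocalField L₂ H₂ hH₂ (triSubmonoid K₂ L₂) N
        (fun _ hx => mem_triSubmonoid_of_pow_eq_one K₂ L₂ N (NeZero.pos N) hx)
        (((Iso.ofLocalFieldTri φ₀ hφ₀ φ hφ L₁ L₂ hL H₁ hH₁ H₂ hH₂ hH).isNHSaturated_iff N).mp h₁)) :=
  Iso.thm24i_ofLocalField (Iso.ofLocalFieldTri φ₀ hφ₀ φ hφ L₁ L₂ hL H₁ hH₁ H₂ hH₂ hH) N fs₁ fs₂ hfs
    (fun _ hx => mem_triSubmonoid_of_pow_eq_one K₁ L₁ N (NeZero.pos N) hx) h₁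
    (fun _ hx => mem_triSubmonoid_of_pow_eq_one K₂ L₂ N (NeZero.pos N) hx)

end FieldIso

end Def22Context

end PadicKummer

end Literature.AlgebraicGeometry.Frobenioids

end
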